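import Mathlib.Analysis.InnerProductSpace.Calculus
import Mathlib.Analysis.SpecialFunctions.Pow.Real
import Mathlib.Analysis.SpecialFunctions.Sqrt
import Mathlib.MeasureTheory.Integral.IntervalIntegral.IntegrationByParts
import Mathlib.Analysis.Calculus.Deriv.Star
import Mathlib.Analysis.Complex.RealDeriv
import Mathlib.Analysis.Calculus.Deriv.Mul
import HarnessLib

/-!
# Resolvent lower bounds for `-ν∂²_y + ikv(y)` from thin level sets (Coti Zelati–Gallay, d = 1)

**Coti Zelati–Gallay** (*Enhanced dissipation and Taylor dispersion in higher-dimensional parallel shear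
flows*, J. London Math. Soc. 108 (2023), arXiv:2108.11192), §2: for the advection–diffusion generator
`H_{ν,k,λ} = -νΔ_y + ik(v(y) − λ)` of a parallel shear flow, **Proposition 2.4** proves the resolvent
(pseudospectral) lower bound `‖H_{ν,k,λ} g‖ ≥ C·λ_{ν,k}‖g‖` with
`λ_{ν,k} = ν^{m/(m+2)}|k|^{2/(m+2)}` if `ν ≤ |k|` (enhanced dissipation) and `λ_{ν,k} = k²/ν` if
`|k| ≤ ν` (Taylor dispersion), with ONE constant `C` for all `ν > 0`, `k ≠ 0`, `λ ∈ ℝ`, under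
**Assumption 2.2** («`H¹`-thin level sets»: the `δ`-neighbourhood `ℰ` of the thickened level set
`{|v − λ| < δ^m}` carries at most half of the `L²` mass up to `C₀δ²‖∇g‖²`). Combined with Wei's
Gearhart–Prüss theorem (`Literature.Analysis.OperatorTheory.GearhartPrussAccretive`) this is the
«resolvent road» to enhanced dissipation ⟷ Taylor dispersion with a continuous transition (their
Theorems 1.1–1.3; Prop. 2.1).

This file proves Proposition 2.4 in dimension `d = 1` on a period cell `[0, L]`, for `C²` functions with
TWISTED-PERIODIC boundary values `g(L) = ω g(0)`, `g′(L) = ω g′(0)`, `‖ω‖ = 1` (all Bloch/Floquet shifts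
of a periodic problem at once; `ω = 1` is the periodic case), the level `λ` being absorbed into `v`
(apply the theorems to `v − λ`). The thin-level-set hypothesis is taken in the form the proof USES
(CZG p. 7, properties i)–iii) of the localiser `χ` and inequality (2.7)): for the given `δ` there are a
real `C¹` localiser `χ` with `|χ| ≤ 1`, `|χ′| ≤ K₁/δ`, `χ·v ≥ 0`, `χ(L) = χ(0)`, and a measurable set `S`
off which `χ·v ≥ δ^m`, such that `∫_S |f|² ≤ ½∫|f|² + C₀δ²∫|f′|²` for all `C¹` functions `f`.
(For a Morse profile such as the Kolmogorov shear `v = sin` this holds with `m = 2`; CZG Lemma 2.6 /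
Remark 3.2. The verification for `sin` is the business of the user file.)

Main results (all constants explicit):
* `norm_le_resolvent_of_thin` — CZG (2.10): for every admissible `δ` (localiser and exceptional set
  given explicitly as hypotheses), `‖g‖ ≤ 4·(C₀δ²/ν + 1/(|k|δ^m) + νK₁²/(k²δ^{2m+2}))·‖Hg‖`
  (`L²(0,L)` norms, written as square roots of interval integrals);
* `HasThinLevelSets L v m C₀ K₁ δ₀` — the one DEFINITION of the file: CZG's Assumption 2.2 packaged
  in the form the proof uses (localiser + exceptional set + thin inequality, all scales `δ ≤ δ₀`);
  `HasThinLevelSets.anti` (shrinking `δ₀`);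
* `resolvent_lower_bound_enhanced_of_thin` — regime `ν ≤ |k|`: `Λ‖g‖ ≤ 4(C₀δ₀² + δ₀^{-m} +
  K₁²δ₀^{-(2m+2)})‖Hg‖` for the rate `Λ > 0` with `Λ^{m+2} = ν^m k²`
  (i.e. `Λ = ν^{m/(m+2)}|k|^{2/(m+2)}`, `rate_rpow_pow_eq`);
* `resolvent_lower_bound_taylor_of_thin` — regime `|k| ≤ ν`: `(k²/ν)‖g‖ ≤ (same constant)‖Hg‖`.
Tools proved on the way: the energy identity `re_integral_resolvent_mul_conj` (`Re⟨Hg, g⟩ = ν‖g′‖²`, CZG (2.5)), the localised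
identity `im_integral_resolvent_mul_localiser_conj` (`Im⟨Hg, χg⟩ = ν Im⟨g′, χ′g⟩ + k⟨χvg, g⟩`) and
its consequence `abs_k_mul_integral_localiser_le` (CZG (2.6)); private plumbing: the twisted-periodic
integration by parts and an integral Cauchy–Schwarz inequality obtained from the one-parameter Young
family.

PROOF (CZG pp. 7–8, followed line by line; `a = ∫|g|²`, `X = ∫|Hg||g|`, `Y = ∫|g′||g|`):
`ν∫|g′|² = Re⟨Hg,g⟩ ≤ X`; `|k|∫χv|g|² ≤ X + (νK₁/δ)Y`; split `a` over `S` and its complement: off `S`,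
`|g|² ≤ δ^{-m}χv|g|²`, on `S` the thin inequality; `Y ≤ K₁∫|g′|² + a/(4K₁)·…` (Young) and
`X ≤ ‖Hg‖‖g‖` (Cauchy–Schwarz) give `a/4 ≤ M·‖Hg‖‖g‖`. The only deviation from print: CZG bound `Y` by
Cauchy–Schwarz and apply Young once at the end; we apply Young to `Y` directly — same constant.

One definition (`HasThinLevelSets`), no named facts; everything else is proved. Written for the
`ad-ideate` cell's K2R crossover lemma (Kolmogorov slot `v = sin`, `m = 2`; the verification of
`HasThinLevelSets` for `sin` and the transfer to Galerkin ladder matrices live in the user files), as the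
`hres` input of `Literature.Analysis.OperatorTheory.GearhartPrussAccretive`.
-/

noncomputable section

namespace Literature.Analysis.OperatorTheory

open scoped Real ComplexConjugate
open _root_.Complex MeasureTheory intervalIntegral Set

section Tools

/-- From the one-parameter family of Young inequalities `X ≤ (s/2)r + a/(2s)` (`s > 0`) to the
Cauchy–Schwarz form `X ≤ √r·√a`. [folklore] -/
private theorem le_sqrt_mul_sqrt_of_forall_young {X r a : ℝ} (hr : 0 ≤ r) (ha : 0 ≤ a)
    (h : ∀ s : ℝ, 0 < s → X ≤ s / 2 * r + a / (2 * s)) : X ≤ Real.sqrt r * Real.sqrt a := by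
  rcases hr.lt_or_eq with hr' | hr'
  · rcases ha.lt_or_eq with ha' | ha'
    · set p := Real.sqrt r with hp
      set q := Real.sqrt a with hq
      have hp0 : 0 < p := Real.sqrt_pos.2 hr'
      have hq0 : 0 < q := Real.sqrt_pos.2 ha'
      have hr2 : r = p ^ 2 := (Real.sq_sqrt hr).symm
      have ha2 : a = q ^ 2 := (Real.sq_sqrt ha).symm
      have key := h (q / p) (div_pos hq0 hp0)
      rw [hr2, ha2] at key
      have : q / p / 2 * p ^ 2 + q ^ 2 / (2 * (q / p)) = p * q := by
        field_simp
        ring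
      linarith
    · -- `a = 0`: `X ≤ (s/2) r` for all `s > 0`
      subst ha'
      simp only [Real.sqrt_zero, mul_zero]
      by_contra hX
      push Not at hX
      have key := h (X / r) (div_pos hX hr')
      have : X / r / 2 * r = X / 2 := by field_simp
      rw [this, zero_div, add_zero] at key
      linarith
  · -- `r = 0`: `X ≤ a/(2s)` for all `s > 0`
    subst hr'
    simp only [Real.sqrt_zero, zero_mul]
    by_contra hX
    push Not at hX
    rcases ha.lt_or_eq with ha' | ha'
    · have key := h (a / X) (div_pos ha' hX)
      have : a / (2 * (a / X)) = X / 2 := by field_simp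
      rw [this, mul_zero, zero_add] at key
      linarith
    · subst ha'
      have key := h 1 one_pos
      simp at key
      linarith

/-- Pointwise Young inequality with parameter: `x y ≤ (s/2) x² + y²/(2s)` for `s > 0`. [folklore] -/
private theorem mul_le_young (x y : ℝ) {s : ℝ} (hs : 0 < s) : x * y ≤ s / 2 * x ^ 2 + y ^ 2 / (2 * s) := by
  have h : 0 ≤ (s * x - y) ^ 2 / (2 * s) := by positivity
  have : (s * x - y) ^ 2 / (2 * s) = s / 2 * x ^ 2 + y ^ 2 / (2 * s) - x * y := by
    field_simp
    ring
  linarith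

/-- **Integral Cauchy–Schwarz on an interval** for continuous real functions:
`∫₀ᴸ φψ ≤ √(∫₀ᴸ φ²)·√(∫₀ᴸ ψ²)`, proved from the Young family. [folklore] -/
private theorem integral_mul_le_sqrt_mul_sqrt {L : ℝ} (hL : 0 ≤ L) {φ ψ : ℝ → ℝ}
    (hφ : ContinuousOn φ (Icc 0 L)) (hψ : ContinuousOn ψ (Icc 0 L)) :
    ∫ y in (0:ℝ)..L, φ y * ψ y ≤
      Real.sqrt (∫ y in (0:ℝ)..L, φ y ^ 2) * Real.sqrt (∫ y in (0:ℝ)..L, ψ y ^ 2) := by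
  have hI : uIcc (0:ℝ) L = Icc 0 L := uIcc_of_le hL
  have hφi : IntervalIntegrable (fun y => φ y ^ 2) volume 0 L :=
    ContinuousOn.intervalIntegrable (by rw [hI]; exact hφ.pow 2)
  have hψi : IntervalIntegrable (fun y => ψ y ^ 2) volume 0 L :=
    ContinuousOn.intervalIntegrable (by rw [hI]; exact hψ.pow 2)
  have hφψ : IntervalIntegrable (fun y => φ y * ψ y) volume 0 L :=
    ContinuousOn.intervalIntegrable (by rw [hI]; exact hφ.mul hψ)
  refine le_sqrt_mul_sqrt_of_forall_young
    (intervalIntegral.integral_nonneg hL fun y _ => sq_nonneg _)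
    (intervalIntegral.integral_nonneg hL fun y _ => sq_nonneg _) fun s hs => ?_
  calc ∫ y in (0:ℝ)..L, φ y * ψ y
      ≤ ∫ y in (0:ℝ)..L, (s / 2 * φ y ^ 2 + ψ y ^ 2 / (2 * s)) :=
        intervalIntegral.integral_mono_on hL hφψ ((hφi.const_mul _).add (hψi.div_const _))
          fun y _ => mul_le_young _ _ hs
    _ = s / 2 * (∫ y in (0:ℝ)..L, φ y ^ 2) + (∫ y in (0:ℝ)..L, ψ y ^ 2) / (2 * s) := by
        rw [intervalIntegral.integral_add (hφi.const_mul _) (hψi.div_const _),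
          intervalIntegral.integral_const_mul, intervalIntegral.integral_div]

/-- **Twisted-periodic integration by parts.** If `u, φ` are `C¹` on `[0, L]` and the boundary
products agree, `u(L)φ(L) = u(0)φ(0)`, then `∫₀ᴸ u′φ = −∫₀ᴸ uφ′`. (For `u = g′`, `φ = χ·ḡ` with
`g(L) = ωg(0)`, `g′(L) = ωg′(0)`, `‖ω‖ = 1`, `χ(L) = χ(0)` the boundary products agree.) [folklore] -/
private theorem integral_deriv_mul_eq_neg_of_twisted {L : ℝ} (hL : 0 ≤ L) {u u' φ φ' : ℝ → ℂ}
    (hu : ∀ y ∈ Icc 0 L, HasDerivAt u (u' y) y) (hφ : ∀ y ∈ Icc 0 L, HasDerivAt φ (φ' y) y)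
    (hu' : ContinuousOn u' (Icc 0 L)) (hφ' : ContinuousOn φ' (Icc 0 L))
    (hbc : u L * φ L = u 0 * φ 0) :
    ∫ y in (0:ℝ)..L, u' y * φ y = -∫ y in (0:ℝ)..L, u y * φ' y := by
  have hI : uIcc (0:ℝ) L = Icc 0 L := uIcc_of_le hL
  have h := intervalIntegral.integral_mul_deriv_eq_deriv_mul (u := u) (v := φ) (u' := u') (v' := φ')
    (fun y hy => hu y (hI ▸ hy)) (fun y hy => hφ y (hI ▸ hy))
    (ContinuousOn.intervalIntegrable (by rw [hI]; exact hu'))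
    (ContinuousOn.intervalIntegrable (by rw [hI]; exact hφ'))
  rw [hbc, sub_self, zero_sub] at h
  rw [h, neg_neg]

end Tools

section Identities

/-! ### The two integral identities of CZG's proof (twisted-periodic boundary values) -/

/-- `ω·conj ω = 1` for a unit complex number. [folklore] -/
private theorem mul_conj_eq_one_of_norm {ω : ℂ} (hω : ‖ω‖ = 1) : ω * conj ω = 1 := by
  rw [Complex.mul_conj, Complex.normSq_eq_norm_sq, hω]; simp

/-- `z·conj z = ‖z‖²` as a complex number. [folklore] -/
private theorem mul_conj_eq_norm_sq (z : ℂ) : z * conj z = ((‖z‖ : ℝ) : ℂ) ^ 2 := by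
  rw [Complex.mul_conj, Complex.normSq_eq_norm_sq, Complex.ofReal_pow]

/-- Product rule for `y ↦ χ(y)·conj g(y)` with `χ` real. [folklore] -/
private theorem hasDerivAt_ofReal_mul_conj {χ : ℝ → ℝ} {χ' : ℝ} {g : ℝ → ℂ} {g' : ℂ} {y : ℝ}
    (hχ : HasDerivAt χ χ' y) (hg : HasDerivAt g g' y) :
    HasDerivAt (fun y => (χ y : ℂ) * conj (g y)) (χ' * conj (g y) + χ y * conj g') y := by
  have h1 : HasDerivAt (fun y => (χ y : ℂ)) χ' y := hχ.ofReal_comp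
  have h2 : HasDerivAt (fun y => conj (g y)) (conj g') y := hg.star
  exact h1.mul h2

/-- **Energy identity** (CZG (2.5), `Re⟨Hg, g⟩ = ν‖g′‖²`): for `C²` functions on `[0, L]` with
twisted-periodic boundary values `g(L) = ωg(0)`, `g′(L) = ωg′(0)`, `‖ω‖ = 1`, and a real profile `v`,
`Re ∫₀ᴸ (−νg″ + ikvg)·ḡ = ν∫₀ᴸ |g′|²`. [cite: CotizelatiGallay2023, §2 (2.5)] -/
theorem re_integral_resolvent_mul_conj {L : ℝ} (hL : 0 ≤ L) (ν k : ℝ) {v : ℝ → ℝ}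
    (hv : ContinuousOn v (Icc 0 L)) {g g' g'' : ℝ → ℂ}
    (hg : ∀ y ∈ Icc 0 L, HasDerivAt g (g' y) y) (hg' : ∀ y ∈ Icc 0 L, HasDerivAt g' (g'' y) y)
    (hg'' : ContinuousOn g'' (Icc 0 L)) {ω : ℂ} (hω : ‖ω‖ = 1) (hbc : g L = ω * g 0)
    (hbc' : g' L = ω * g' 0) :
    (∫ y in (0:ℝ)..L, (-(ν:ℂ) * g'' y + I * k * v y * g y) * conj (g y)).re
      = ν * ∫ y in (0:ℝ)..L, ‖g' y‖ ^ 2 := by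
  have hI : uIcc (0:ℝ) L = Icc 0 L := uIcc_of_le hL
  have hgc : ContinuousOn g (Icc 0 L) := fun y hy => (hg y hy).continuousAt.continuousWithinAt
  have hg'c : ContinuousOn g' (Icc 0 L) := fun y hy => (hg' y hy).continuousAt.continuousWithinAt
  have hcg : ContinuousOn (fun y => conj (g y)) (Icc 0 L) :=
    Complex.continuous_conj.comp_continuousOn hgc
  have hcg' : ContinuousOn (fun y => conj (g' y)) (Icc 0 L) :=
    Complex.continuous_conj.comp_continuousOn hg'c
  have hvc : ContinuousOn (fun y => (v y : ℂ)) (Icc 0 L) :=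
    Complex.continuous_ofReal.comp_continuousOn hv
  -- (i) `∫ g″ ḡ = −∫ g′ conj g′`
  have h1 : ∫ y in (0:ℝ)..L, g'' y * conj (g y) = -∫ y in (0:ℝ)..L, g' y * conj (g' y) := by
    refine integral_deriv_mul_eq_neg_of_twisted hL hg' (φ := fun y => conj (g y))
      (φ' := fun y => conj (g' y)) (fun y hy => ?_) hg'' hcg' ?_
    · simpa using (hg y hy).star
    · rw [hbc, hbc', map_mul]
      calc ω * g' 0 * (conj ω * conj (g 0)) = (ω * conj ω) * (g' 0 * conj (g 0)) := by ring
        _ = g' 0 * conj (g 0) := by rw [mul_conj_eq_one_of_norm hω, one_mul]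
  -- (ii) `∫ g′ conj g′ = ∫ |g′|²`
  have h2 : ∫ y in (0:ℝ)..L, g' y * conj (g' y) = ((∫ y in (0:ℝ)..L, ‖g' y‖ ^ 2 : ℝ) : ℂ) := by
    rw [← intervalIntegral.integral_ofReal]
    exact intervalIntegral.integral_congr fun y _ => by
      rw [mul_conj_eq_norm_sq]; norm_cast
  -- (iii) the advection term is purely imaginary
  have h3 : ∫ y in (0:ℝ)..L, I * k * v y * g y * conj (g y)
      = I * ((∫ y in (0:ℝ)..L, k * v y * ‖g y‖ ^ 2 : ℝ) : ℂ) := by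
    rw [← intervalIntegral.integral_ofReal, ← intervalIntegral.integral_const_mul]
    refine intervalIntegral.integral_congr fun y _ => ?_
    have := mul_conj_eq_norm_sq (g y)
    push_cast
    linear_combination (I * k * v y) * this
  -- split the integral
  have hint1 : IntervalIntegrable (fun y => -(ν:ℂ) * (g'' y * conj (g y))) volume 0 L :=
    ContinuousOn.intervalIntegrable (by rw [hI]; exact (hg''.mul hcg).const_smul (-(ν:ℂ)))
  have hint2 : IntervalIntegrable (fun y => I * k * v y * g y * conj (g y)) volume 0 L :=
    ContinuousOn.intervalIntegrable (by
      rw [hI]; exact (((hvc.const_smul (I * k)).mul hgc).mul hcg))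
  have hsplit : ∫ y in (0:ℝ)..L, (-(ν:ℂ) * g'' y + I * k * v y * g y) * conj (g y)
      = -(ν:ℂ) * (∫ y in (0:ℝ)..L, g'' y * conj (g y))
        + ∫ y in (0:ℝ)..L, I * k * v y * g y * conj (g y) := by
    rw [← intervalIntegral.integral_const_mul, ← intervalIntegral.integral_add hint1 hint2]
    exact intervalIntegral.integral_congr fun y _ => by ring
  rw [hsplit, h1, h2, h3]
  simp [Complex.mul_re]

/-- **Localised identity** (CZG p. 7, «a direct calculation shows that
`Im⟨Hg, χg⟩ = ν Im⟨∇g, g∇χ⟩ + k⟨χ(v−λ)g, g⟩`»): for a real `C¹` localiser `χ` with `χ(L) = χ(0)` and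
`g` as in `re_integral_resolvent_mul_conj`,
`Im ∫₀ᴸ (−νg″ + ikvg)·χḡ = ν·Im ∫₀ᴸ g′χ′ḡ + k∫₀ᴸ χv|g|²`. [cite: CotizelatiGallay2023, §2 proof of Prop. 2.4] -/
theorem im_integral_resolvent_mul_localiser_conj {L : ℝ} (hL : 0 ≤ L) (ν k : ℝ) {v : ℝ → ℝ}
    (hv : ContinuousOn v (Icc 0 L)) {g g' g'' : ℝ → ℂ}
    (hg : ∀ y ∈ Icc 0 L, HasDerivAt g (g' y) y) (hg' : ∀ y ∈ Icc 0 L, HasDerivAt g' (g'' y) y)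
    (hg'' : ContinuousOn g'' (Icc 0 L)) {ω : ℂ} (hω : ‖ω‖ = 1) (hbc : g L = ω * g 0)
    (hbc' : g' L = ω * g' 0) {χ χ' : ℝ → ℝ} (hχ : ∀ y ∈ Icc 0 L, HasDerivAt χ (χ' y) y)
    (hχ' : ContinuousOn χ' (Icc 0 L)) (hχbc : χ L = χ 0) :
    (∫ y in (0:ℝ)..L, (-(ν:ℂ) * g'' y + I * k * v y * g y) * (χ y * conj (g y))).im
      = ν * (∫ y in (0:ℝ)..L, g' y * (χ' y * conj (g y))).im
        + k * ∫ y in (0:ℝ)..L, χ y * v y * ‖g y‖ ^ 2 := by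
  have hI : uIcc (0:ℝ) L = Icc 0 L := uIcc_of_le hL
  have hgc : ContinuousOn g (Icc 0 L) := fun y hy => (hg y hy).continuousAt.continuousWithinAt
  have hg'c : ContinuousOn g' (Icc 0 L) := fun y hy => (hg' y hy).continuousAt.continuousWithinAt
  have hχc : ContinuousOn χ (Icc 0 L) := fun y hy => (hχ y hy).continuousAt.continuousWithinAt
  have hcg : ContinuousOn (fun y => conj (g y)) (Icc 0 L) :=
    Complex.continuous_conj.comp_continuousOn hgc
  have hcg' : ContinuousOn (fun y => conj (g' y)) (Icc 0 L) :=
    Complex.continuous_conj.comp_continuousOn hg'c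
  have hvc : ContinuousOn (fun y => (v y : ℂ)) (Icc 0 L) :=
    Complex.continuous_ofReal.comp_continuousOn hv
  have hχcc : ContinuousOn (fun y => (χ y : ℂ)) (Icc 0 L) :=
    Complex.continuous_ofReal.comp_continuousOn hχc
  have hχ'cc : ContinuousOn (fun y => (χ' y : ℂ)) (Icc 0 L) :=
    Complex.continuous_ofReal.comp_continuousOn hχ'
  -- (i) `∫ g″ χḡ = −∫ g′ (χ′ḡ + χ conj g′)`
  have h1 : ∫ y in (0:ℝ)..L, g'' y * (χ y * conj (g y))
      = -∫ y in (0:ℝ)..L, g' y * (χ' y * conj (g y) + χ y * conj (g' y)) := by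
    refine integral_deriv_mul_eq_neg_of_twisted hL hg' (φ := fun y => (χ y : ℂ) * conj (g y))
      (φ' := fun y => (χ' y : ℂ) * conj (g y) + χ y * conj (g' y)) (fun y hy => ?_) hg''
      ((hχ'cc.mul hcg).add (hχcc.mul hcg')) ?_
    · exact hasDerivAt_ofReal_mul_conj (hχ y hy) (hg y hy)
    · rw [hbc, hbc', hχbc, map_mul]
      calc ω * g' 0 * (↑(χ 0) * (conj ω * conj (g 0)))
          = (ω * conj ω) * (g' 0 * (↑(χ 0) * conj (g 0))) := by ring
        _ = g' 0 * (↑(χ 0) * conj (g 0)) := by rw [mul_conj_eq_one_of_norm hω, one_mul]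
  -- (ii) `∫ g′ χ conj g′` is real
  have h2 : ∫ y in (0:ℝ)..L, g' y * (χ y * conj (g' y))
      = ((∫ y in (0:ℝ)..L, χ y * ‖g' y‖ ^ 2 : ℝ) : ℂ) := by
    rw [← intervalIntegral.integral_ofReal]
    refine intervalIntegral.integral_congr fun y _ => ?_
    have := mul_conj_eq_norm_sq (g' y)
    push_cast
    linear_combination (χ y : ℂ) * this
  -- (iii) the advection term
  have h3 : ∫ y in (0:ℝ)..L, I * k * v y * g y * (χ y * conj (g y))
      = I * ((∫ y in (0:ℝ)..L, k * (χ y * v y * ‖g y‖ ^ 2) : ℝ) : ℂ) := by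
    rw [← intervalIntegral.integral_ofReal, ← intervalIntegral.integral_const_mul]
    refine intervalIntegral.integral_congr fun y _ => ?_
    have := mul_conj_eq_norm_sq (g y)
    push_cast
    linear_combination (I * k * v y * χ y) * this
  have hint1 : IntervalIntegrable (fun y => -(ν:ℂ) * (g'' y * (χ y * conj (g y)))) volume 0 L :=
    ContinuousOn.intervalIntegrable (by
      rw [hI]; exact (hg''.mul (hχcc.mul hcg)).const_smul (-(ν:ℂ)))
  have hint2 : IntervalIntegrable (fun y => I * k * v y * g y * (χ y * conj (g y))) volume 0 L :=
    ContinuousOn.intervalIntegrable (by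
      rw [hI]; exact (((hvc.const_smul (I * k)).mul hgc).mul (hχcc.mul hcg)))
  have hint3 : IntervalIntegrable (fun y => g' y * (χ' y * conj (g y))) volume 0 L :=
    ContinuousOn.intervalIntegrable (by rw [hI]; exact hg'c.mul (hχ'cc.mul hcg))
  have hint4 : IntervalIntegrable (fun y => g' y * (χ y * conj (g' y))) volume 0 L :=
    ContinuousOn.intervalIntegrable (by rw [hI]; exact hg'c.mul (hχcc.mul hcg'))
  have hsplit : ∫ y in (0:ℝ)..L, (-(ν:ℂ) * g'' y + I * k * v y * g y) * (χ y * conj (g y))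
      = -(ν:ℂ) * (∫ y in (0:ℝ)..L, g'' y * (χ y * conj (g y)))
        + ∫ y in (0:ℝ)..L, I * k * v y * g y * (χ y * conj (g y)) := by
    rw [← intervalIntegral.integral_const_mul, ← intervalIntegral.integral_add hint1 hint2]
    exact intervalIntegral.integral_congr fun y _ => by ring
  have hsplit2 : ∫ y in (0:ℝ)..L, g' y * (χ' y * conj (g y) + χ y * conj (g' y))
      = (∫ y in (0:ℝ)..L, g' y * (χ' y * conj (g y)))
        + ∫ y in (0:ℝ)..L, g' y * (χ y * conj (g' y)) := by
    rw [← intervalIntegral.integral_add hint3 hint4]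
    exact intervalIntegral.integral_congr fun y _ => by ring
  rw [hsplit, h1, hsplit2, h2, h3, intervalIntegral.integral_const_mul]
  simp [Complex.mul_re, Complex.mul_im]

/-- **CZG (2.6)**: with `|χ| ≤ 1`, `|χ′| ≤ K` and `χv ≥ 0` on `[0, L]`,
`|k|·∫₀ᴸ χv|g|² ≤ ∫₀ᴸ |Hg||g| + νK∫₀ᴸ |g′||g|`, `Hg = −νg″ + ikvg`. [cite: CotizelatiGallay2023, §2 (2.6)] -/
theorem abs_k_mul_integral_localiser_le {L : ℝ} (hL : 0 ≤ L) {ν : ℝ} (hν : 0 ≤ ν) (k : ℝ)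
    {v : ℝ → ℝ} (hv : ContinuousOn v (Icc 0 L)) {g g' g'' : ℝ → ℂ}
    (hg : ∀ y ∈ Icc 0 L, HasDerivAt g (g' y) y) (hg' : ∀ y ∈ Icc 0 L, HasDerivAt g' (g'' y) y)
    (hg'' : ContinuousOn g'' (Icc 0 L)) {ω : ℂ} (hω : ‖ω‖ = 1) (hbc : g L = ω * g 0)
    (hbc' : g' L = ω * g' 0) {χ χ' : ℝ → ℝ} (hχ : ∀ y ∈ Icc 0 L, HasDerivAt χ (χ' y) y)
    (hχ' : ContinuousOn χ' (Icc 0 L)) (hχbc : χ L = χ 0) (hχ1 : ∀ y ∈ Icc 0 L, |χ y| ≤ 1)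
    {K : ℝ} (hχ'K : ∀ y ∈ Icc 0 L, |χ' y| ≤ K) (hpos : ∀ y ∈ Icc 0 L, 0 ≤ χ y * v y) :
    |k| * ∫ y in (0:ℝ)..L, χ y * v y * ‖g y‖ ^ 2
      ≤ (∫ y in (0:ℝ)..L, ‖-(ν:ℂ) * g'' y + I * k * v y * g y‖ * ‖g y‖)
        + ν * K * ∫ y in (0:ℝ)..L, ‖g' y‖ * ‖g y‖ := by
  have hI : uIcc (0:ℝ) L = Icc 0 L := uIcc_of_le hL
  have hgc : ContinuousOn g (Icc 0 L) := fun y hy => (hg y hy).continuousAt.continuousWithinAt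
  have hg'c : ContinuousOn g' (Icc 0 L) := fun y hy => (hg' y hy).continuousAt.continuousWithinAt
  have hχc : ContinuousOn χ (Icc 0 L) := fun y hy => (hχ y hy).continuousAt.continuousWithinAt
  have hcg : ContinuousOn (fun y => conj (g y)) (Icc 0 L) :=
    Complex.continuous_conj.comp_continuousOn hgc
  have hvc : ContinuousOn (fun y => (v y : ℂ)) (Icc 0 L) :=
    Complex.continuous_ofReal.comp_continuousOn hv
  have hχcc : ContinuousOn (fun y => (χ y : ℂ)) (Icc 0 L) :=
    Complex.continuous_ofReal.comp_continuousOn hχc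
  have hχ'cc : ContinuousOn (fun y => (χ' y : ℂ)) (Icc 0 L) :=
    Complex.continuous_ofReal.comp_continuousOn hχ'
  have hhc : ContinuousOn (fun y => -(ν:ℂ) * g'' y + I * k * v y * g y) (Icc 0 L) :=
    (hg''.const_smul (-(ν:ℂ))).add ((hvc.const_smul (I * k)).mul hgc)
  have hK : 0 ≤ K := (abs_nonneg _).trans (hχ'K 0 ⟨le_rfl, hL⟩)
  have hid := im_integral_resolvent_mul_localiser_conj hL ν k hv hg hg' hg'' hω hbc hbc' hχ hχ' hχbc
  set Z := ∫ y in (0:ℝ)..L, χ y * v y * ‖g y‖ ^ 2 with hZ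
  have hZ0 : 0 ≤ Z := intervalIntegral.integral_nonneg hL fun y hy =>
    mul_nonneg (hpos y hy) (sq_nonneg _)
  -- `|Im ∫ Hg·χḡ| ≤ ∫ |Hg||g|`
  have hA : |(∫ y in (0:ℝ)..L, (-(ν:ℂ) * g'' y + I * k * v y * g y) * (χ y * conj (g y))).im|
      ≤ ∫ y in (0:ℝ)..L, ‖-(ν:ℂ) * g'' y + I * k * v y * g y‖ * ‖g y‖ := by
    refine (Complex.abs_im_le_norm _).trans ((intervalIntegral.norm_integral_le_integral_norm hL).trans ?_)
    refine intervalIntegral.integral_mono_on hL ?_ ?_ fun y hy => ?_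
    · exact ContinuousOn.intervalIntegrable (by rw [hI]; exact (hhc.mul (hχcc.mul hcg)).norm)
    · exact ContinuousOn.intervalIntegrable (by rw [hI]; exact hhc.norm.mul hgc.norm)
    · rw [norm_mul, norm_mul, Complex.norm_real, Complex.norm_conj, Real.norm_eq_abs]
      have h1 := hχ1 y hy
      have : ‖-(ν:ℂ) * g'' y + I * k * v y * g y‖ * (|χ y| * ‖g y‖)
          ≤ ‖-(ν:ℂ) * g'' y + I * k * v y * g y‖ * (1 * ‖g y‖) := by
        gcongr
      simpa using this
  -- `|Im ∫ g′χ′ḡ| ≤ K ∫ |g′||g|`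
  have hB : |(∫ y in (0:ℝ)..L, g' y * (χ' y * conj (g y))).im|
      ≤ K * ∫ y in (0:ℝ)..L, ‖g' y‖ * ‖g y‖ := by
    refine (Complex.abs_im_le_norm _).trans ((intervalIntegral.norm_integral_le_integral_norm hL).trans ?_)
    rw [← intervalIntegral.integral_const_mul]
    refine intervalIntegral.integral_mono_on hL ?_ ?_ fun y hy => ?_
    · exact ContinuousOn.intervalIntegrable (by rw [hI]; exact (hg'c.mul (hχ'cc.mul hcg)).norm)
    · exact ContinuousOn.intervalIntegrable (by rw [hI]; exact (hg'c.norm.mul hgc.norm).const_smul K)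
    · rw [norm_mul, norm_mul, Complex.norm_real, Complex.norm_conj, Real.norm_eq_abs]
      have h1 := hχ'K y hy
      have : ‖g' y‖ * (|χ' y| * ‖g y‖) ≤ ‖g' y‖ * (K * ‖g y‖) := by gcongr
      nlinarith [this]
  -- assemble: `kZ = Im ∫Hgχḡ − ν Im ∫ g′χ′ḡ`
  have hkZ : k * Z = (∫ y in (0:ℝ)..L, (-(ν:ℂ) * g'' y + I * k * v y * g y) * (χ y * conj (g y))).im
      - ν * (∫ y in (0:ℝ)..L, g' y * (χ' y * conj (g y))).im := by
    rw [hid]; ring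
  calc |k| * Z = |k * Z| := by rw [abs_mul, abs_of_nonneg hZ0]
    _ ≤ |(∫ y in (0:ℝ)..L, (-(ν:ℂ) * g'' y + I * k * v y * g y) * (χ y * conj (g y))).im|
        + ν * |(∫ y in (0:ℝ)..L, g' y * (χ' y * conj (g y))).im| := by
        rw [hkZ]
        refine (abs_sub _ _).trans ?_
        rw [abs_mul, abs_of_nonneg hν]
    _ ≤ _ := by
        have := mul_le_mul_of_nonneg_left hB hν
        nlinarith [hA, this]

end Identities

section Assembly

/-- **CZG (2.10) — the resolvent bound at a fixed localisation scale `δ`.** Let `g` be `C²` on `[0, L]`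
with twisted-periodic boundary values (`g(L) = ωg(0)`, `g′(L) = ωg′(0)`, `‖ω‖ = 1`), `v` a continuous
real profile, `ν > 0`, `k ≠ 0`, and suppose that at scale `δ > 0` there are a real `C¹` localiser `χ`
(`|χ| ≤ 1`, `|χ′| ≤ K₁/δ`, `χv ≥ 0`, `χ(L) = χ(0)`) and a measurable set `S` with `χv ≥ δ^m` off `S`
on which `g` obeys the thin-set inequality `∫_S |g|² ≤ ½∫|g|² + C₀δ²∫|g′|²`. Then
`‖g‖ ≤ 4·(C₀δ²/ν + 1/(|k|δ^m) + νK₁²/(k²δ^{2m+2}))·‖−νg″ + ikvg‖` in `L²(0, L)`.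
[cite: CotizelatiGallay2023, §2 Prop. 2.4, (2.10)] -/
theorem norm_le_resolvent_of_thin {L : ℝ} (hL : 0 ≤ L) {ν : ℝ} (hν : 0 < ν) {k : ℝ} (hk : k ≠ 0)
    {v : ℝ → ℝ} (hv : ContinuousOn v (Icc 0 L)) {g g' g'' : ℝ → ℂ}
    (hg : ∀ y ∈ Icc 0 L, HasDerivAt g (g' y) y) (hg' : ∀ y ∈ Icc 0 L, HasDerivAt g' (g'' y) y)
    (hg'' : ContinuousOn g'' (Icc 0 L)) {ω : ℂ} (hω : ‖ω‖ = 1) (hbc : g L = ω * g 0)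
    (hbc' : g' L = ω * g' 0) {δ : ℝ} (hδ : 0 < δ) {m : ℕ} {C₀ K₁ : ℝ} (hC₀ : 0 ≤ C₀)
    (hK₁ : 0 < K₁) {χ χ' : ℝ → ℝ} (hχ : ∀ y ∈ Icc 0 L, HasDerivAt χ (χ' y) y)
    (hχ' : ContinuousOn χ' (Icc 0 L)) (hχbc : χ L = χ 0) (hχ1 : ∀ y ∈ Icc 0 L, |χ y| ≤ 1)
    (hχ'K : ∀ y ∈ Icc 0 L, |χ' y| ≤ K₁ / δ) (hpos : ∀ y ∈ Icc 0 L, 0 ≤ χ y * v y)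
    {S : Set ℝ} (hS : MeasurableSet S) (hoff : ∀ y ∈ Icc 0 L, y ∉ S → δ ^ m ≤ χ y * v y)
    (hthin : ∫ y in S ∩ Ioc 0 L, ‖g y‖ ^ 2
      ≤ 1 / 2 * (∫ y in (0:ℝ)..L, ‖g y‖ ^ 2) + C₀ * δ ^ 2 * ∫ y in (0:ℝ)..L, ‖g' y‖ ^ 2) :
    Real.sqrt (∫ y in (0:ℝ)..L, ‖g y‖ ^ 2)
      ≤ 4 * (C₀ * δ ^ 2 / ν + 1 / (|k| * δ ^ m) + ν * K₁ ^ 2 / (k ^ 2 * δ ^ (2 * m + 2)))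
        * Real.sqrt (∫ y in (0:ℝ)..L, ‖-(ν:ℂ) * g'' y + I * k * v y * g y‖ ^ 2) := by
  have hI : uIcc (0:ℝ) L = Icc 0 L := uIcc_of_le hL
  have hkpos : 0 < |k| := abs_pos.2 hk
  have hgc : ContinuousOn g (Icc 0 L) := fun y hy => (hg y hy).continuousAt.continuousWithinAt
  have hg'c : ContinuousOn g' (Icc 0 L) := fun y hy => (hg' y hy).continuousAt.continuousWithinAt
  have hχc : ContinuousOn χ (Icc 0 L) := fun y hy => (hχ y hy).continuousAt.continuousWithinAt
  have hcg : ContinuousOn (fun y => conj (g y)) (Icc 0 L) :=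
    Complex.continuous_conj.comp_continuousOn hgc
  have hvc : ContinuousOn (fun y => (v y : ℂ)) (Icc 0 L) :=
    Complex.continuous_ofReal.comp_continuousOn hv
  have hhc : ContinuousOn (fun y => -(ν:ℂ) * g'' y + I * k * v y * g y) (Icc 0 L) :=
    (hg''.const_smul (-(ν:ℂ))).add ((hvc.const_smul (I * k)).mul hgc)
  set a := ∫ y in (0:ℝ)..L, ‖g y‖ ^ 2 with ha
  set b := ∫ y in (0:ℝ)..L, ‖g' y‖ ^ 2 with hb
  set r := ∫ y in (0:ℝ)..L, ‖-(ν:ℂ) * g'' y + I * k * v y * g y‖ ^ 2 with hr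
  set X := ∫ y in (0:ℝ)..L, ‖-(ν:ℂ) * g'' y + I * k * v y * g y‖ * ‖g y‖ with hX
  set Y := ∫ y in (0:ℝ)..L, ‖g' y‖ * ‖g y‖ with hY
  set Z := ∫ y in (0:ℝ)..L, χ y * v y * ‖g y‖ ^ 2 with hZ
  have ha0 : 0 ≤ a := intervalIntegral.integral_nonneg hL fun y _ => sq_nonneg _
  have hr0 : 0 ≤ r := intervalIntegral.integral_nonneg hL fun y _ => sq_nonneg _
  -- (F1) `ν b ≤ X` from the energy identity
  have hF1 : ν * b ≤ X := by
    have hre := re_integral_resolvent_mul_conj hL ν k hv hg hg' hg'' hω hbc hbc'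
    rw [← hre]
    refine (Complex.abs_re_le_norm _).trans' (le_abs_self _) |>.trans ?_
    refine (intervalIntegral.norm_integral_le_integral_norm hL).trans (le_of_eq ?_)
    exact intervalIntegral.integral_congr fun y _ => by
      simp only [norm_mul, Complex.norm_conj]
  -- (F2) the localised inequality
  have hF2 : |k| * Z ≤ X + ν * (K₁ / δ) * Y :=
    abs_k_mul_integral_localiser_le hL hν.le k hv hg hg' hg'' hω hbc hbc' hχ hχ' hχbc hχ1 hχ'K hpos
  -- (F3) split `a` over `S`
  have hgsq : IntegrableOn (fun y => ‖g y‖ ^ 2) (Ioc 0 L) :=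
    ((hgc.norm.pow 2).integrableOn_Icc).mono_set Ioc_subset_Icc_self
  have hχvg : IntegrableOn (fun y => (δ ^ m)⁻¹ * (χ y * v y * ‖g y‖ ^ 2)) (Ioc 0 L) :=
    ((((hχc.mul hv).mul (hgc.norm.pow 2)).const_smul ((δ ^ m)⁻¹)).integrableOn_Icc).mono_set
      Ioc_subset_Icc_self
  have hsplit : a = (∫ y in Ioc 0 L ∩ S, ‖g y‖ ^ 2) + ∫ y in Ioc 0 L \ S, ‖g y‖ ^ 2 := by
    rw [ha, intervalIntegral.integral_of_le hL, integral_inter_add_sdiff hS hgsq]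
  -- (F4) off `S`: `|g|² ≤ δ^{-m} χ v |g|²`
  have hδm : 0 < δ ^ m := pow_pos hδ m
  have hF4 : ∫ y in Ioc 0 L \ S, ‖g y‖ ^ 2 ≤ (δ ^ m)⁻¹ * Z := by
    calc ∫ y in Ioc 0 L \ S, ‖g y‖ ^ 2
        ≤ ∫ y in Ioc 0 L \ S, (δ ^ m)⁻¹ * (χ y * v y * ‖g y‖ ^ 2) := by
          refine setIntegral_mono_on (hgsq.mono_set Set.sdiff_subset)
            (hχvg.mono_set Set.sdiff_subset) (measurableSet_Ioc.diff hS) fun y hy => ?_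
          have hyI : y ∈ Icc 0 L := Ioc_subset_Icc_self hy.1
          have h1 := hoff y hyI hy.2
          calc ‖g y‖ ^ 2 = (δ ^ m)⁻¹ * (δ ^ m * ‖g y‖ ^ 2) := by
                rw [← mul_assoc, inv_mul_cancel₀ hδm.ne', one_mul]
            _ ≤ (δ ^ m)⁻¹ * (χ y * v y * ‖g y‖ ^ 2) :=
                mul_le_mul_of_nonneg_left (mul_le_mul_of_nonneg_right h1 (sq_nonneg _))
                  (inv_nonneg.2 hδm.le)
      _ ≤ ∫ y in Ioc 0 L, (δ ^ m)⁻¹ * (χ y * v y * ‖g y‖ ^ 2) := by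
          refine setIntegral_mono_set hχvg ?_ Set.sdiff_subset.eventuallyLE
          refine ae_restrict_of_forall_mem measurableSet_Ioc fun y hy => ?_
          exact mul_nonneg (inv_nonneg.2 hδm.le)
            (mul_nonneg (hpos y (Ioc_subset_Icc_self hy)) (sq_nonneg _))
      _ = (δ ^ m)⁻¹ * Z := by
          rw [MeasureTheory.integral_const_mul, hZ, intervalIntegral.integral_of_le hL]
  -- (F5) on `S`: the thin inequality
  have hF5 : ∫ y in Ioc 0 L ∩ S, ‖g y‖ ^ 2 ≤ 1 / 2 * a + C₀ * δ ^ 2 * b := by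
    rw [inter_comm]; exact hthin
  -- Young for `Y` with parameter `2Q₁`
  set Q₁ := (δ ^ m)⁻¹ * |k|⁻¹ * (ν * (K₁ / δ)) with hQ₁
  have hQ₁pos : 0 < Q₁ := by positivity
  have hYoung : Y ≤ Q₁ * b + a / (4 * Q₁) := by
    have hint1 : IntervalIntegrable (fun y => ‖g' y‖ * ‖g y‖) volume 0 L :=
      ContinuousOn.intervalIntegrable (by rw [hI]; exact hg'c.norm.mul hgc.norm)
    have hb' : IntervalIntegrable (fun y => ‖g' y‖ ^ 2) volume 0 L :=
      ContinuousOn.intervalIntegrable (by rw [hI]; exact hg'c.norm.pow 2)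
    have ha' : IntervalIntegrable (fun y => ‖g y‖ ^ 2) volume 0 L :=
      ContinuousOn.intervalIntegrable (by rw [hI]; exact hgc.norm.pow 2)
    calc Y ≤ ∫ y in (0:ℝ)..L, ((2 * Q₁) / 2 * ‖g' y‖ ^ 2 + ‖g y‖ ^ 2 / (2 * (2 * Q₁))) :=
          intervalIntegral.integral_mono_on hL hint1 ((hb'.const_mul _).add (ha'.div_const _))
            fun y _ => mul_le_young _ _ (by positivity)
      _ = (2 * Q₁) / 2 * b + a / (2 * (2 * Q₁)) := by
          rw [intervalIntegral.integral_add (hb'.const_mul _) (ha'.div_const _),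
            intervalIntegral.integral_const_mul, intervalIntegral.integral_div]
      _ = Q₁ * b + a / (4 * Q₁) := by ring
  -- the bookkeeping (CZG (2.8)–(2.10))
  have hbX : b ≤ X / ν := by rw [le_div_iff₀ hν]; linarith
  have hZ' : Z ≤ |k|⁻¹ * X + |k|⁻¹ * (ν * (K₁ / δ)) * Y := by
    have e : Z = |k|⁻¹ * (|k| * Z) := by field_simp
    rw [e]
    have := mul_le_mul_of_nonneg_left hF2 (inv_nonneg.2 hkpos.le)
    linarith
  have h1 : C₀ * δ ^ 2 * b ≤ C₀ * δ ^ 2 / ν * X := by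
    have := mul_le_mul_of_nonneg_left hbX (by positivity : 0 ≤ C₀ * δ ^ 2)
    have e : C₀ * δ ^ 2 * (X / ν) = C₀ * δ ^ 2 / ν * X := by ring
    linarith
  have h2 : (δ ^ m)⁻¹ * Z ≤ (δ ^ m)⁻¹ * |k|⁻¹ * X + Q₁ * Y := by
    calc (δ ^ m)⁻¹ * Z ≤ (δ ^ m)⁻¹ * (|k|⁻¹ * X + |k|⁻¹ * (ν * (K₁ / δ)) * Y) :=
          mul_le_mul_of_nonneg_left hZ' (inv_nonneg.2 hδm.le)
      _ = (δ ^ m)⁻¹ * |k|⁻¹ * X + Q₁ * Y := by rw [hQ₁]; ring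
  have h3 : Q₁ * Y ≤ Q₁ ^ 2 / ν * X + a / 4 := by
    have hQY := mul_le_mul_of_nonneg_left hYoung hQ₁pos.le
    have hb2 := mul_le_mul_of_nonneg_left hbX (sq_nonneg Q₁)
    have e1 : Q₁ * (Q₁ * b + a / (4 * Q₁)) = Q₁ ^ 2 * b + a / 4 := by
      field_simp
    have e2 : Q₁ ^ 2 * (X / ν) = Q₁ ^ 2 / ν * X := by ring
    linarith
  have hmain : a / 4 ≤ (C₀ * δ ^ 2 / ν + (δ ^ m)⁻¹ * |k|⁻¹ + Q₁ ^ 2 / ν) * X := by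
    linarith [hsplit, hF5, hF4, h1, h2, h3]
  -- Cauchy–Schwarz `X ≤ ‖Hg‖‖g‖`
  have hCS : X ≤ Real.sqrt r * Real.sqrt a :=
    integral_mul_le_sqrt_mul_sqrt (φ := fun y => ‖-(ν:ℂ) * g'' y + I * k * v y * g y‖)
      (ψ := fun y => ‖g y‖) hL hhc.norm hgc.norm
  -- conclusion
  set M := C₀ * δ ^ 2 / ν + (δ ^ m)⁻¹ * |k|⁻¹ + Q₁ ^ 2 / ν with hM
  have hM0 : 0 ≤ M := by positivity
  have hMeq : M = C₀ * δ ^ 2 / ν + 1 / (|k| * δ ^ m) + ν * K₁ ^ 2 / (k ^ 2 * δ ^ (2 * m + 2)) := by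
    have hT2 : (δ ^ m)⁻¹ * |k|⁻¹ = 1 / (|k| * δ ^ m) := by
      rw [one_div, mul_inv, mul_comm]
    have hD : δ ^ m * |k| * δ ≠ 0 := by positivity
    have hQ₁' : Q₁ = ν * K₁ / (δ ^ m * |k| * δ) := by
      rw [hQ₁, eq_div_iff hD]
      field_simp
    have hD2 : (δ ^ m * |k| * δ) ^ 2 = k ^ 2 * δ ^ (2 * m + 2) := by
      rw [mul_pow, mul_pow, sq_abs]; ring
    have hT3 : Q₁ ^ 2 / ν = ν * K₁ ^ 2 / (k ^ 2 * δ ^ (2 * m + 2)) := by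
      rw [hQ₁', div_pow, hD2, mul_pow, div_div, div_eq_div_iff (by positivity) (by positivity)]
      ring
    rw [hM, hT2, hT3]
  rw [← hMeq]
  set A := Real.sqrt a with hA
  set R := Real.sqrt r with hR
  have hA0 : 0 ≤ A := Real.sqrt_nonneg _
  have hR0 : 0 ≤ R := Real.sqrt_nonneg _
  have haA : a = A ^ 2 := (Real.sq_sqrt ha0).symm
  have key : A ^ 2 / 4 ≤ M * (R * A) := by
    rw [← haA]; exact hmain.trans (mul_le_mul_of_nonneg_left hCS hM0)
  rcases hA0.lt_or_eq with hApos | hA0'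
  · have h : A / 4 * A ≤ M * R * A := by
      have e1 : A / 4 * A = A ^ 2 / 4 := by ring
      have e2 : M * R * A = M * (R * A) := by ring
      rw [e1, e2]; exact key
    have := le_of_mul_le_mul_right h hApos
    linarith only [this]
  · have h0 : 0 ≤ 4 * M * R := mul_nonneg (mul_nonneg (by norm_num) hM0) hR0
    linarith only [h0, hA0']

end Assembly

section Regimes

/-- **Thin level sets at all scales `δ ≤ δ₀`** (Coti Zelati–Gallay's Assumption 2.2 in the form the
proof of their Prop. 2.4 uses it — properties i)–iii) of the localiser and inequality (2.7) — for the
level `0` of a real profile `v` on the period cell `[0, L]`): for every `δ ∈ (0, δ₀]` there are a real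
`C¹` localiser `χ` on `[0, L]` with `|χ| ≤ 1`, `|χ′| ≤ K₁/δ`, `χ·v ≥ 0`, `χ(L) = χ(0)` (a regularised
`sign v`), and a measurable exceptional set `S` (the `δ`-neighbourhood of the thickened level set) with
`χ·v ≥ δ^m` off `S`, such that every `C¹` function `f` on `[0, L]` satisfies the thin-set inequality
`∫_{S ∩ (0,L]} |f|² ≤ ½∫₀ᴸ |f|² + C₀δ² ∫₀ᴸ |f′|²`. For the level `λ` of `v` use `v − λ`; `m` is the
degeneracy index (`m = 1`: no critical points; `m = 2`: Morse profiles such as the Kolmogorov shear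
`sin`, CZG Remark 3.2). [cite: CotizelatiGallay2023, §2 Assumption 2.2, (2.7), proof of Prop. 2.4 i)–iii)] -/
def HasThinLevelSets (L : ℝ) (v : ℝ → ℝ) (m : ℕ) (C₀ K₁ δ₀ : ℝ) : Prop :=
  ∀ δ : ℝ, 0 < δ → δ ≤ δ₀ → ∃ (χ χ' : ℝ → ℝ) (S : Set ℝ),
    (∀ y ∈ Icc 0 L, HasDerivAt χ (χ' y) y) ∧ ContinuousOn χ' (Icc 0 L) ∧ χ L = χ 0 ∧
    (∀ y ∈ Icc 0 L, |χ y| ≤ 1) ∧ (∀ y ∈ Icc 0 L, |χ' y| ≤ K₁ / δ) ∧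
    (∀ y ∈ Icc 0 L, 0 ≤ χ y * v y) ∧ MeasurableSet S ∧
    (∀ y ∈ Icc 0 L, y ∉ S → δ ^ m ≤ χ y * v y) ∧
    ∀ f f' : ℝ → ℂ, (∀ y ∈ Icc 0 L, HasDerivAt f (f' y) y) → ContinuousOn f' (Icc 0 L) →
      ∫ y in S ∩ Ioc 0 L, ‖f y‖ ^ 2
        ≤ 1 / 2 * (∫ y in (0:ℝ)..L, ‖f y‖ ^ 2) + C₀ * δ ^ 2 * ∫ y in (0:ℝ)..L, ‖f' y‖ ^ 2

/-- Shrinking the scale range preserves the thin-level-set property. [cite: CotizelatiGallay2023, §2 Assumption 2.2] -/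
theorem HasThinLevelSets.anti {L : ℝ} {v : ℝ → ℝ} {m : ℕ} {C₀ K₁ δ₀ δ₀' : ℝ}
    (h : HasThinLevelSets L v m C₀ K₁ δ₀) (hδ : δ₀' ≤ δ₀) : HasThinLevelSets L v m C₀ K₁ δ₀' :=
  fun δ hδ0 hδ1 => h δ hδ0 (hδ1.trans hδ)

/-- The enhanced-dissipation rate `Λ = ν^{m/(m+2)}|k|^{2/(m+2)}` satisfies `Λ^{m+2} = ν^m k²`
(the polynomial characterisation used in `resolvent_lower_bound_enhanced_of_thin`). [cite: CotizelatiGallay2023, §1 (1.7)] -/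
theorem rate_rpow_pow_eq {ν : ℝ} (hν : 0 ≤ ν) (k : ℝ) (m : ℕ) :
    (ν ^ ((m:ℝ) / (m + 2)) * |k| ^ ((2:ℝ) / (m + 2))) ^ (m + 2) = ν ^ m * k ^ 2 := by
  have hm : ((m:ℝ) + 2) ≠ 0 := by positivity
  rw [mul_pow, ← Real.rpow_natCast (ν ^ _), ← Real.rpow_natCast (|k| ^ _),
    ← Real.rpow_mul hν, ← Real.rpow_mul (abs_nonneg k)]
  push_cast
  rw [div_mul_cancel₀ _ hm, div_mul_cancel₀ _ hm, Real.rpow_natCast,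
    show ((2:ℝ)) = ((2:ℕ):ℝ) by norm_num, Real.rpow_natCast, sq_abs]

/-- **Enhanced-dissipation regime `ν ≤ |k|`** (CZG Prop. 2.4, first case of (2.11)–(2.12)): under
`HasThinLevelSets L v m C₀ K₁ δ₀`, for every `C²` function `g` on `[0, L]` with twisted-periodic boundary
values, `Λ·‖g‖ ≤ 4(C₀δ₀² + δ₀^{−m} + K₁²δ₀^{−(2m+2)})·‖−νg″ + ikvg‖` in `L²(0, L)`, where `Λ > 0` is the
rate `ν^{m/(m+2)}|k|^{2/(m+2)}`, characterised by `Λ^{m+2} = ν^m k²` (`rate_rpow_pow_eq`). The constant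
does not depend on `ν`, `k`, `g`. [cite: CotizelatiGallay2023, §2 Prop. 2.4] -/
theorem resolvent_lower_bound_enhanced_of_thin {L : ℝ} (hL : 0 ≤ L) {ν : ℝ} (hν : 0 < ν) {k : ℝ}
    (hk : k ≠ 0) {v : ℝ → ℝ} (hv : ContinuousOn v (Icc 0 L)) {m : ℕ} {C₀ K₁ δ₀ : ℝ}
    (hC₀ : 0 ≤ C₀) (hK₁ : 0 < K₁) (hδ₀ : 0 < δ₀) (hthin : HasThinLevelSets L v m C₀ K₁ δ₀)
    {g g' g'' : ℝ → ℂ} (hg : ∀ y ∈ Icc 0 L, HasDerivAt g (g' y) y)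
    (hg' : ∀ y ∈ Icc 0 L, HasDerivAt g' (g'' y) y) (hg'' : ContinuousOn g'' (Icc 0 L)) {ω : ℂ}
    (hω : ‖ω‖ = 1) (hbc : g L = ω * g 0) (hbc' : g' L = ω * g' 0) (hνk : ν ≤ |k|) {Λ : ℝ}
    (hΛ : 0 < Λ) (hΛeq : Λ ^ (m + 2) = ν ^ m * k ^ 2) :
    Λ * Real.sqrt (∫ y in (0:ℝ)..L, ‖g y‖ ^ 2)
      ≤ 4 * (C₀ * δ₀ ^ 2 + (δ₀ ^ m)⁻¹ + K₁ ^ 2 * (δ₀ ^ (2 * m + 2))⁻¹)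
        * Real.sqrt (∫ y in (0:ℝ)..L, ‖-(ν:ℂ) * g'' y + I * k * v y * g y‖ ^ 2) := by
  have hkpos : 0 < |k| := abs_pos.2 hk
  have hg'c : ContinuousOn g' (Icc 0 L) := fun y hy => (hg' y hy).continuousAt.continuousWithinAt
  -- `ν ≤ Λ`
  have hνΛ : ν ≤ Λ := by
    have h1 : ν ^ (m + 2) ≤ Λ ^ (m + 2) := by
      rw [hΛeq, pow_add]
      refine mul_le_mul_of_nonneg_left ?_ (pow_nonneg hν.le m)
      rw [← sq_abs k]
      exact pow_le_pow_left₀ hν.le hνk 2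
    exact (pow_le_pow_iff_left₀ hν.le hΛ.le (by omega)).mp h1
  -- the localisation scale `δ = δ₀ √(ν/Λ)`
  set s := Real.sqrt (ν / Λ) with hs
  have hs0 : 0 < s := Real.sqrt_pos.2 (div_pos hν hΛ)
  have hs2 : s ^ 2 = ν / Λ := Real.sq_sqrt (div_pos hν hΛ).le
  have hs1 : s ≤ 1 := by
    rw [hs, Real.sqrt_le_one]
    exact (div_le_one hΛ).2 hνΛ
  set δ := δ₀ * s with hδ
  have hδpos : 0 < δ := mul_pos hδ₀ hs0
  have hδle : δ ≤ δ₀ := mul_le_of_le_one_right hδ₀.le hs1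
  obtain ⟨χ, χ', S, hχ, hχ', hχbc, hχ1, hχ'K, hpos, hS, hoff, hthinf⟩ := hthin δ hδpos hδle
  have H := norm_le_resolvent_of_thin hL hν hk hv hg hg' hg'' hω hbc hbc' hδpos hC₀ hK₁ hχ hχ' hχbc
    hχ1 hχ'K hpos hS hoff (hthinf g g' hg hg'c)
  -- `Λ · M(δ) = M₀`
  have hk2 : k ^ 2 = Λ ^ (m + 2) / ν ^ m := by
    rw [hΛeq]; field_simp
  have hks : |k| * s ^ m = Λ := by
    have h2 : (|k| * s ^ m) ^ 2 = Λ ^ 2 := by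
      rw [mul_pow, sq_abs, ← pow_mul, mul_comm m 2, pow_mul, hs2, hk2, div_pow]
      field_simp
      ring
    exact (pow_left_inj₀ (by positivity) hΛ.le two_ne_zero).mp h2
  have hT1 : Λ * (C₀ * δ ^ 2 / ν) = C₀ * δ₀ ^ 2 := by
    rw [hδ, mul_pow, hs2]
    field_simp
  have hT2 : Λ * (1 / (|k| * δ ^ m)) = (δ₀ ^ m)⁻¹ := by
    rw [hδ, mul_pow, show |k| * (δ₀ ^ m * s ^ m) = δ₀ ^ m * Λ by rw [← hks]; ring]
    field_simp
  have hT3 : Λ * (ν * K₁ ^ 2 / (k ^ 2 * δ ^ (2 * m + 2))) = K₁ ^ 2 * (δ₀ ^ (2 * m + 2))⁻¹ := by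
    have hδp : δ ^ (2 * m + 2) = δ₀ ^ (2 * m + 2) * (ν / Λ) ^ (m + 1) := by
      rw [hδ, mul_pow, ← hs2, ← pow_mul]; ring_nf
    rw [hδp, hk2, div_pow]
    field_simp
    ring
  have hMeq : Λ * (C₀ * δ ^ 2 / ν + 1 / (|k| * δ ^ m) + ν * K₁ ^ 2 / (k ^ 2 * δ ^ (2 * m + 2)))
      = C₀ * δ₀ ^ 2 + (δ₀ ^ m)⁻¹ + K₁ ^ 2 * (δ₀ ^ (2 * m + 2))⁻¹ := by
    rw [mul_add, mul_add, hT1, hT2, hT3]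
  calc Λ * Real.sqrt (∫ y in (0:ℝ)..L, ‖g y‖ ^ 2)
      ≤ Λ * (4 * (C₀ * δ ^ 2 / ν + 1 / (|k| * δ ^ m) + ν * K₁ ^ 2 / (k ^ 2 * δ ^ (2 * m + 2)))
        * Real.sqrt (∫ y in (0:ℝ)..L, ‖-(ν:ℂ) * g'' y + I * k * v y * g y‖ ^ 2)) :=
        mul_le_mul_of_nonneg_left H hΛ.le
    _ = _ := by rw [← hMeq]; ring

/-- **Taylor-dispersion regime `|k| ≤ ν`** (CZG Prop. 2.4, second case of (2.11)–(2.12); for this half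
CZG «really only used that `v` is twice differentiable», their Thm 1.3 / Lemma 2.5 need only one fixed
scale): under `HasThinLevelSets L v m C₀ K₁ δ₀`,
`(k²/ν)·‖g‖ ≤ 4(C₀δ₀² + δ₀^{−m} + K₁²δ₀^{−(2m+2)})·‖−νg″ + ikvg‖` in `L²(0, L)` — the SAME constant as
in the enhanced-dissipation regime (continuous transition at `ν = |k|`). [cite: CotizelatiGallay2023, §2 Prop. 2.4] -/
theorem resolvent_lower_bound_taylor_of_thin {L : ℝ} (hL : 0 ≤ L) {ν : ℝ} (hν : 0 < ν) {k : ℝ}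
    (hk : k ≠ 0) {v : ℝ → ℝ} (hv : ContinuousOn v (Icc 0 L)) {m : ℕ} {C₀ K₁ δ₀ : ℝ}
    (hC₀ : 0 ≤ C₀) (hK₁ : 0 < K₁) (hδ₀ : 0 < δ₀) (hthin : HasThinLevelSets L v m C₀ K₁ δ₀)
    {g g' g'' : ℝ → ℂ} (hg : ∀ y ∈ Icc 0 L, HasDerivAt g (g' y) y)
    (hg' : ∀ y ∈ Icc 0 L, HasDerivAt g' (g'' y) y) (hg'' : ContinuousOn g'' (Icc 0 L)) {ω : ℂ}
    (hω : ‖ω‖ = 1) (hbc : g L = ω * g 0) (hbc' : g' L = ω * g' 0) (hkν : |k| ≤ ν) :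
    k ^ 2 / ν * Real.sqrt (∫ y in (0:ℝ)..L, ‖g y‖ ^ 2)
      ≤ 4 * (C₀ * δ₀ ^ 2 + (δ₀ ^ m)⁻¹ + K₁ ^ 2 * (δ₀ ^ (2 * m + 2))⁻¹)
        * Real.sqrt (∫ y in (0:ℝ)..L, ‖-(ν:ℂ) * g'' y + I * k * v y * g y‖ ^ 2) := by
  have hkpos : 0 < |k| := abs_pos.2 hk
  have hg'c : ContinuousOn g' (Icc 0 L) := fun y hy => (hg' y hy).continuousAt.continuousWithinAt
  obtain ⟨χ, χ', S, hχ, hχ', hχbc, hχ1, hχ'K, hpos, hS, hoff, hthinf⟩ := hthin δ₀ hδ₀ le_rfl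
  have H := norm_le_resolvent_of_thin hL hν hk hv hg hg' hg'' hω hbc hbc' hδ₀ hC₀ hK₁ hχ hχ' hχbc
    hχ1 hχ'K hpos hS hoff (hthinf g g' hg hg'c)
  have hr0 : 0 ≤ Real.sqrt (∫ y in (0:ℝ)..L, ‖-(ν:ℂ) * g'' y + I * k * v y * g y‖ ^ 2) :=
    Real.sqrt_nonneg _
  have hk2 : k ^ 2 = |k| ^ 2 := (sq_abs k).symm
  -- `(k²/ν)·M(δ₀) ≤ M₀`
  have hT1 : k ^ 2 / ν * (C₀ * δ₀ ^ 2 / ν) ≤ C₀ * δ₀ ^ 2 := by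
    have h1 : k ^ 2 / ν * (C₀ * δ₀ ^ 2 / ν) = (|k| / ν) ^ 2 * (C₀ * δ₀ ^ 2) := by
      rw [hk2]; field_simp
    rw [h1]
    have h2 : (|k| / ν) ^ 2 ≤ 1 := by
      rw [div_pow, div_le_one (by positivity)]
      exact pow_le_pow_left₀ hkpos.le hkν 2
    nlinarith [mul_nonneg hC₀ (sq_nonneg δ₀)]
  have hT2 : k ^ 2 / ν * (1 / (|k| * δ₀ ^ m)) ≤ (δ₀ ^ m)⁻¹ := by
    have h1 : k ^ 2 / ν * (1 / (|k| * δ₀ ^ m)) = (|k| / ν) * (δ₀ ^ m)⁻¹ := by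
      rw [hk2]; field_simp
    rw [h1]
    have h2 : |k| / ν ≤ 1 := (div_le_one hν).2 hkν
    have h3 : 0 ≤ (δ₀ ^ m)⁻¹ := by positivity
    nlinarith
  have hT3 : k ^ 2 / ν * (ν * K₁ ^ 2 / (k ^ 2 * δ₀ ^ (2 * m + 2))) = K₁ ^ 2 * (δ₀ ^ (2 * m + 2))⁻¹ := by
    field_simp
  have hMle : k ^ 2 / ν * (C₀ * δ₀ ^ 2 / ν + 1 / (|k| * δ₀ ^ m) + ν * K₁ ^ 2 / (k ^ 2 * δ₀ ^ (2 * m + 2)))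
      ≤ C₀ * δ₀ ^ 2 + (δ₀ ^ m)⁻¹ + K₁ ^ 2 * (δ₀ ^ (2 * m + 2))⁻¹ := by
    rw [mul_add, mul_add, hT3]; linarith
  calc k ^ 2 / ν * Real.sqrt (∫ y in (0:ℝ)..L, ‖g y‖ ^ 2)
      ≤ k ^ 2 / ν * (4 * (C₀ * δ₀ ^ 2 / ν + 1 / (|k| * δ₀ ^ m) + ν * K₁ ^ 2 / (k ^ 2 * δ₀ ^ (2 * m + 2)))
        * Real.sqrt (∫ y in (0:ℝ)..L, ‖-(ν:ℂ) * g'' y + I * k * v y * g y‖ ^ 2)) :=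
        mul_le_mul_of_nonneg_left H (by positivity)
    _ = 4 * (k ^ 2 / ν * (C₀ * δ₀ ^ 2 / ν + 1 / (|k| * δ₀ ^ m)
          + ν * K₁ ^ 2 / (k ^ 2 * δ₀ ^ (2 * m + 2))))
        * Real.sqrt (∫ y in (0:ℝ)..L, ‖-(ν:ℂ) * g'' y + I * k * v y * g y‖ ^ 2) := by ring
    _ ≤ _ := by gcongr

end Regimes




end Literature.Analysis.OperatorTheory

end
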